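import Summits.FinalStateConjecture.FinalStateConjecture.Theorems.StarvedNecksHonestFixedRadiusSettlingStubFarExitEnd
import Summits.FinalStateConjecture.FinalStateConjecture.Theorems.StarvedNecksHonestFixedRadiusSettlingStubFarExitEnergy

/-!
# Crux `HonestFixedRadiusSettling` · line `sojourn-needs-only-one-over-delta` · stub `stub_farExit`
# Layer H1 (c): the exact components on the far zone

Helper file for `stmt-FinalStateConjecture-13550` (stub `stub_farExit`). On the far zone
`‖y⃗‖ ≥ 16M + |a| + 1` of the `(t_BL-type, x_KS)` chart of the exact Kerr end (`0 ≤ M`, `|a| ≤ M`),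
the exact components `G = (toKS)^* g_{M,a}` (hypotheses-by-equation `hS`, `hG` as in
`…StubFarExitEnd`) are smooth and nondegenerate, `e₀` is uniformly timelike
(`G(e₀, e₀) ≤ −7/8`), and the two inequalities driving the far-exit transport hold:
* `zone_null_energy`: a `G`-null vector `u` with Killing energy `E = −G(u, e₀) > 0` has chart rate
  `0 < u⁰ ≤ 2E` and coordinate speed `‖u⃗‖ ≤ (6/5) u⁰`;
* `zone_energy_pinning`: if `u` is normalised against the `G`-unit future normal of the slice
  `{y⁰ = const}`, then `E ≤ 5`.
Both are transfers along `D toKS = id + (dh ∘ spatial) ⊗ e₀` (`‖dh‖ ≤ 1/6`) of the Kerr–Schild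
statements of `…StubFarExitEnergy` (`H ≤ 1/16` there).

References: R. P. Kerr, A. Schild (1965), §2–§3; M. Visser, arXiv:0706.0622, (32)–(35);
G. B. Cook, Living Rev. Relativ. 3 (2000) 5, §3.2.2.
-/

set_option linter.dupNamespace false

noncomputable section

open Literature.Geometry.Lorentzian
open scoped Manifold ContDiff Topology
open Filter Set

namespace Summit.FinalStateConjecture.FinalStateConjecture.Theorems.StarvedNecks.OneOverDelta.FarEnd

open Summit.FinalStateConjecture.FinalStateConjecture.Theorems.KerrShieldedDataExist.Negative

/-! ## The exact components on the far zone: null vectors, chart rate, energy pinning -/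

section Zone

variable {M a : ℝ} {S : E4 → E4} {G : E4 → E4 →L[ℝ] E4 →L[ℝ] ℝ}
  (hS : ∀ y, S y = y + bentHeightFun M a (E4.spatial y) • E4.basisVector 0)
  (hG : ∀ y, G y = (Kerr.bilin M a (S y)).bilinearComp (fderiv ℝ S y) (fderiv ℝ S y))
include hS hG

omit hG in
/-- **The differential of `toKS` on the far zone** is the shear
`id + (d(bentHeightFun)_{y⃗} ∘ spatial) ⊗ e₀`. [folklore] -/
theorem fderiv_toKS_far (hM : 0 ≤ M) (ha : |a| ≤ M) {y : E4}
    (hy : 16 * M + |a| + 1 ≤ E4.spatialNorm y) :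
    fderiv ℝ S y = ContinuousLinearMap.id ℝ E4 +
      ((fderiv ℝ (bentHeightFun M a) (E4.spatial y)).comp E4.spatial).smulRight (E4.basisVector 0) := by
  obtain ⟨-, hr0, -⟩ := far_numerics hM ha (x := E4.spatial y) hy
  have hd : DifferentiableAt ℝ (bentHeightFun M a) (E4.spatial y) :=
    (contDiffAt_bentHeightFun_of_abs_le hM ha hr0 (n := 1)).differentiableAt (by simp)
  have hSdef : S = fun y ↦ y + bentHeightFun M a (E4.spatial y) • E4.basisVector 0 := funext hS
  rw [hSdef]
  exact (hasFDerivAt_shear (y := y) hd.hasFDerivAt).fderiv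

/-- **The exact components are smooth on the far zone.** [cite: KerrSchild1965, §3] -/
theorem contDiffAt_components_far (hM : 0 ≤ M) (ha : |a| ≤ M) {y : E4}
    (hy : 16 * M + |a| + 1 ≤ E4.spatialNorm y) {n : ℕ∞} : ContDiffAt ℝ n G y := by
  obtain ⟨hr0, -, -⟩ := far_numerics' hM ha hy
  obtain ⟨-, hr0', -⟩ := far_numerics hM ha (x := E4.spatial y) hy
  exact contDiffAt_components hS hG hr0 (contDiffAt_bentHeightFun_of_abs_le hM ha hr0')

/-- **The exact components are nondegenerate on the far zone.** [cite: KerrSchild1965, §2] -/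
theorem components_nondegenerate_far (hM : 0 ≤ M) (ha : |a| ≤ M) {y : E4}
    (hy : 16 * M + |a| + 1 ≤ E4.spatialNorm y) (u : E4) (hu : ∀ v, G y u v = 0) : u = 0 := by
  obtain ⟨hr0, -, -⟩ := far_numerics' hM ha hy
  obtain ⟨-, hr0', -⟩ := far_numerics hM ha (x := E4.spatial y) hy
  exact components_nondegenerate hS hG hr0
    ((contDiffAt_bentHeightFun_of_abs_le hM ha hr0' (n := 1)).differentiableAt (by simp)) u hu

/-- **`e₀` is timelike on the far zone**: `G y (e₀, e₀) ≤ −7/8`. [cite: arXiv07060622, (32)–(33)] -/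
theorem components_basisVector_zero_far (hM : 0 ≤ M) (ha : |a| ≤ M) {y : E4}
    (hy : 16 * M + |a| + 1 ≤ E4.spatialNorm y) :
    G y (E4.basisVector 0) (E4.basisVector 0) ≤ -(7 / 8) := by
  obtain ⟨-, hH, -⟩ := far_numerics' hM ha hy
  obtain ⟨-, hr0', -⟩ := far_numerics hM ha (x := E4.spatial y) hy
  rw [components_basisVector_zero hS hG
    ((contDiffAt_bentHeightFun_of_abs_le hM ha hr0' (n := 1)).differentiableAt (by simp))]
  linarith

/-- **Null vectors of the exact end on the far zone: chart rate and coordinate speed.** For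
`‖y⃗‖ ≥ 16M + |a| + 1`, a `G y`-null vector `u` with positive Killing energy `E = −G y (u, e₀)` has
`0 < u⁰ ≤ 2E` and `‖u⃗‖ ≤ (6/5) u⁰` (transfer to the Kerr–Schild form along `D toKS`, where
`ks_null_energy_far` applies with `H ≤ 1/16`, and back with the slope budget `1/6`).
[cite: arXiv07060622, (32)–(35)] -/
theorem zone_null_energy (hM : 0 ≤ M) (ha : |a| ≤ M) {y : E4}
    (hy : 16 * M + |a| + 1 ≤ E4.spatialNorm y) {u : E4} (hnull : G y u u = 0)
    (hE : 0 < -(G y u (E4.basisVector 0))) :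
    0 < u 0 ∧ u 0 ≤ 2 * -(G y u (E4.basisVector 0)) ∧ E4.spatialNorm u ≤ 6 / 5 * u 0 := by
  obtain ⟨hr0, hH, hθ⟩ := far_numerics' hM ha hy
  have hfd := fderiv_toKS_far hS hM ha hy
  set ℓ : E4 →L[ℝ] ℝ := (fderiv ℝ (bentHeightFun M a) (E4.spatial y)).comp E4.spatial with hℓ_def
  have hℓ0 : ℓ (E4.basisVector 0) = 0 := comp_spatial_basisVector_zero _
  set v : E4 := fderiv ℝ S y u with hv_def
  have hv : v = u + ℓ u • E4.basisVector 0 := by rw [hv_def, hfd, shearCLM_apply]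
  have hv0 : v 0 = u 0 + ℓ u := by rw [hv]; simp
  have hvsp : E4.spatialNorm v = E4.spatialNorm u := by
    rw [E4.spatialNorm, E4.spatialNorm, hv, Kerr.spatial_add_smul_basisVector_zero]
  have he0 : fderiv ℝ S y (E4.basisVector 0) = E4.basisVector 0 := by
    rw [hfd]; exact shearCLM_basisVector_zero hℓ0
  have hnull' : Kerr.bilin M a y v v = 0 := by rwa [components_apply hS hG] at hnull
  have hE' : -(G y u (E4.basisVector 0)) = -(Kerr.bilin M a y v (E4.basisVector 0)) := by
    rw [components_apply hS hG, he0]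
  rw [hE'] at hE ⊢
  obtain ⟨hv0pos, hNv, hElo, -⟩ := ks_null_energy_far hM hr0 hH hnull' hE
  have hℓu : |ℓ u| ≤ 1 / 6 * E4.spatialNorm u := abs_comp_spatial_le hθ u
  have hℓu' := abs_le.1 hℓu
  rw [hvsp] at hNv
  refine ⟨by linarith [hℓu'.2], by linarith [hℓu'.1], by linarith [hℓu'.2]⟩

/-- **The normalisation pins the energy on the far zone.** For `‖y⃗‖ ≥ 16M + |a| + 1`: if `n` is
`G y`-normal to the slice directions `(0, q)`, unit timelike and future (`G y (n, e₀) < 0`), and the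
`G y`-null vector `w` is normalised by `G y (w, n) = −1` with `E = −G y (w, e₀) > 0`, then `E ≤ 5`
(transfer to `ks_energy_pinning` along `D toKS`, which maps `(0, q)` to the graph direction
`(dh q, q)`). [cite: Cook2000, §3.2.2] -/
theorem zone_energy_pinning (hM : 0 ≤ M) (ha : |a| ≤ M) {y : E4}
    (hy : 16 * M + |a| + 1 ≤ E4.spatialNorm y) {n w : E4}
    (hN1 : ∀ q : E3, G y n (E4.ofTimeSpace 0 q) = 0) (hN2 : G y n n = -1)
    (hN3 : G y n (E4.basisVector 0) < 0) (hW1 : G y w w = 0) (hW2 : G y w n = -1)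
    (hE : 0 < -(G y w (E4.basisVector 0))) : -(G y w (E4.basisVector 0)) ≤ 5 := by
  obtain ⟨hr0, hH, hθ⟩ := far_numerics' hM ha hy
  have hfd := fderiv_toKS_far hS hM ha hy
  set dh : E3 →L[ℝ] ℝ := fderiv ℝ (bentHeightFun M a) (E4.spatial y) with hdh_def
  set ℓ : E4 →L[ℝ] ℝ := dh.comp E4.spatial with hℓ_def
  have hℓ0 : ℓ (E4.basisVector 0) = 0 := comp_spatial_basisVector_zero _
  have he0 : fderiv ℝ S y (E4.basisVector 0) = E4.basisVector 0 := by
    rw [hfd]; exact shearCLM_basisVector_zero hℓ0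
  have hq : ∀ q : E3, fderiv ℝ S y (E4.ofTimeSpace 0 q) = E4.ofTimeSpace (dh q) q := by
    intro q
    rw [hfd, shearCLM_apply, hℓ_def, ContinuousLinearMap.comp_apply, E4.spatial_ofTimeSpace]
    ext i
    refine Fin.cases ?_ (fun j ↦ ?_) i
    · simp
    · simp [Fin.succ_ne_zero]
  simp only [components_apply hS hG, he0, hq] at hN1 hN2 hN3 hW1 hW2 hE ⊢
  exact ks_energy_pinning hM hr0 hH hθ hN1 hN2 hN3 hW1 hW2 hE

end Zone

/-- **Deciding theorem of this helper file (registered stub `farExit_zone_null_energy`)**: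
`zone_null_energy` with explicit binders and the height function spelled out. [cite: arXiv07060622, (32)–(35)] -/
theorem farExit_zone_null_energy : ∀ (M a : ℝ) (S : E4 → E4) (G : E4 → E4 →L[ℝ] E4 →L[ℝ] ℝ) (y u : E4), (∀ y, S y = y + Summit.FinalStateConjecture.FinalStateConjecture.Theorems.KerrShieldedDataExist.Negative.bentHeightFun M a (E4.spatial y) • E4.basisVector 0) → (∀ y, G y = (Kerr.bilin M a (S y)).bilinearComp (fderiv ℝ S y) (fderiv ℝ S y)) → 0 ≤ M → |a| ≤ M → 16 * M + |a| + 1 ≤ E4.spatialNorm y → G y u u = 0 → 0 < -(G y u (E4.basisVector 0)) → 0 < u 0 ∧ u 0 ≤ 2 * -(G y u (E4.basisVector 0)) ∧ E4.spatialNorm u ≤ 6 / 5 * u 0 :=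
  fun _ _ _ _ _ _ hS hG hM ha hy hnull hE ↦ zone_null_energy hS hG hM ha hy hnull hE

end Summit.FinalStateConjecture.FinalStateConjecture.Theorems.StarvedNecks.OneOverDelta.FarEnd

end
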